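import Summits.QuantumFields.BalabanUV.T4Continuum.Support.NE3CovariantBlockPoincare
import Summits.QuantumFields.BalabanUV.T4Continuum.Support.NE3NestedBlockMeanBridge
import HarnessLib

/-!
# T⁴ programme, node NE3 — route H♮ (ruling ρ-g22-2), row K6 input K6-Ξ: THE POINCARÉ INEQUALITY ON THE NESTED-BLOCK-MEAN-ZERO
# GAUGE PARAMETERS — `bmeanIterW L k W ξ = 0 ⇒ Σ nhsNormSq ξ ≤ 4·(L^k)²·Σ_yΣ_μ nhsNormSq (gaugeDir W ξ y μ)` (k-FREE, N-FREE)

NE3 (node U1b), row NE3 OWNER `b2b-balaban-t4-ne3-p1` (gen 23); the (S8) input of the K6 ASSEMBLY BLUEPRINT (RULING ρ-g23-3,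
journal l.19107; memo `HOME/t4/b2b-balaban-t4-ne3-p1/g23/D-ne3p1-g23-1.md` §1 (S8)): the cross term `2·Σ hsR (ρ)(ζ̃′)` equals
`2·Σ hsR (ρ)(ξ)`, `ξ := ζ̃′ − ζ′ ∈ Ξ₀₀(W)` (spectral orthogonality `⟨ρ, ζ′⟩ = 0`), and is small because `‖ξ‖₂ ≤ C·M·‖gaugeDir W ξ‖₂` —
THIS FILE proves that Poincaré inequality for every `ξ` with vanishing NESTED transported block mean (`NE3FrameFreeSliceW.mem_cornerGaugeSpaceW_iff`:
`Ξ₀₀(W) = {ξ ∈ Ξ₀ : bmeanIterW L k W ξ = 0}`), by COMPOSING two landed modules BY NAME: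
* K2 `NE3CovariantBlockPoincare.sum_nhsNormSq_sub_combMean_le` (leaf-04): per block,
  `Σ_v nhsNormSq (ξ(q+v) − Ad_{btree(q+v)}⁻¹ (bmeanW M W ξ z)) ≤ M²·Σ_vΣ_μ nhsNormSq (gaugeDir W ξ (q+v) μ) + 4d(M(d−1)(M−1)a)²·Σ_v nhsNormSq (ξ(q+v))`;
* J2 `NE3NestedBlockMeanBridge.sum_nhsNormSq_bmeanIterW_sub_bmeanW_le` (NE3-R2 g8): on the torus,
  `Σ_z M^d·nhsNormSq (bmeanIterW L k W ξ z − bmeanW M W ξ z) ≤ card n·C_J2²·Σ_y nhsNormSq (ξ y)`, `C_J2 = 4d²(M−1)²x + 16d·loopRad(d,L,r_{k−1})`.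
With `bmeanIterW … ξ = 0` the transported single-scale mean has torus mass `≤ card n·C_J2²·Σ nhsNormSq ξ`, so
`Σ nhsNormSq ξ ≤ 2M²·G(ξ) + (8d((d−1)M(M−1)x)² + 2·card n·C_J2²)·Σ nhsNormSq ξ`, and under the displayed smallness
`8d((d−1)M(M−1)x)² + 2·card n·C_J2² ≤ 1∕2` (both `O((b∕L²)²)` in the chart's class, k-free): **`Σ nhsNormSq ξ ≤ 4M²·G(ξ)`**.

CONTENT (all [folklore]; 0 sorry; 0 def; `M = L^{j+1}`): §1 `sum_nhsNormSq_Ad_inv_const` (a transported block constant has mass `M^d·nhsNormSq c`),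
`sum_nhsNormSq_le_two_blocks` (the per-block two-term split summed over the torus); §2 **`sum_nhsNormSq_le_of_bmeanIterW_eq_zero`** (the
inequality with the absorbable mass term displayed) and **`sum_nhsNormSq_le_four_mul_of_bmeanIterW_eq_zero`** (the absorbed form).

HONEST FRAMING.  A composition of two landed kinematic modules on OUR typed objects; nothing about Bałaban's minimisers; (P♮)_W, (ML_w) at
W ≠ 1, T-E_w and NE3 are NOT proved; spine PROVED 0∕9; finite T⁴ rung (B)+1 — NOT infinite volume, NOT mass gap, NOT BetaPertH, NOT Clay.
ABSOLUTE RULE kept (context only: [Balaban1985PropagatorsII] (3.46); [Balaban1985Averaging] (42) p. 23).  PLACEMENT: `Summits/QuantumFields/BalabanUV/`.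
-/

set_option autoImplicit false

open scoped BigOperators Matrix.Norms.L2Operator
open Finset

namespace Summit.QuantumFields.BalabanUV.T4Continuum.NE3CornerGaugePoincare

open Literature.MathematicalPhysics.QuantumFieldTheory.Balaban1983to89
open B7Prop1Explicit B7Prop2Explicit MatrixNorms
open T4AveragingDeficitWall (IsUnitaryCfg SmallField Ad)
open T4AveragingDeficitWallBoundary (periodBox)
open T4AveragingDeficitNonAbelian (Ad_sub)
open AveragingDeficitHSInner (nhsNormSq_Ad)
open AveragingDeficitTwoLevelPrep (prop1Radius)
open AveragingDeficitMultiLevelPrep (LevelSmall)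
open AveragingDeficitBlockDensity (btree btree_mem)
open BlockAveragePushDirGauge (gaugeDir)
open NE3CovariantBlockMean (bmeanW bmeanIterW)
open NE3CovariantCalculus (nhsNormSq_sub_le nhsNormSq_neg)
open NE3CovariantBlockPoincare (sum_nhsNormSq_sub_combMean_le)
open NE3NestedBlockMeanBridge (sum_nhsNormSq_bmeanIterW_sub_bmeanW_le)
open NE3BlockPoincareCore (sum_blocks_torus)
open SpreadLift (loopRad)

noncomputable section

variable {d : ℕ} {n : Type*} [Fintype n] [DecidableEq n]

/-! ## §1 Bookkeeping -/

/-- A transported block constant has torus mass `M^d·nhsNormSq c` per block (unitary transports). [folklore] -/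
theorem sum_nhsNormSq_Ad_inv_const {M : ℕ} {W : Site d → Fin d → (Matrix n n ℂ)ˣ} (hWu : IsUnitaryCfg W) (z : Site d)
    (c : Matrix n n ℂ) :
    ∑ v ∈ periodBox (d := d) M, nhsNormSq (Ad (btree M W z ((M : ℤ) • z + v))⁻¹ c) = (M : ℝ) ^ d * nhsNormSq c := by
  rw [sum_congr rfl fun v _ => nhsNormSq_Ad ((unitaryUnits _).inv_mem (btree_mem hWu M z _)) c, sum_const,
    T4AveragingDeficitWallBoundary.card_periodBox, nsmul_eq_mul]
  push_cast; ring

/-- **THE TWO-TERM SPLIT ON THE TORUS** (unitary `W`, `SmallField W a`, `0 ≤ a`, `M ≥ 1`, ANY `ξ`):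
`Σ_{y∈periodBox(M·N)} nhsNormSq (ξ y) ≤ 2M²·Σ_yΣ_μ nhsNormSq (gaugeDir W ξ y μ) + 8d(M(d−1)(M−1)a)²·Σ_y nhsNormSq (ξ y)
  + 2·Σ_{z∈periodBox N} M^d·nhsNormSq (bmeanW M W ξ z)` (K2 per block + the mass of the transported means). [folklore] -/
theorem sum_nhsNormSq_le_two_blocks [Nonempty n] {M : ℕ} (hM : 1 ≤ M) (N : ℕ) {W : Site d → Fin d → (Matrix n n ℂ)ˣ}
    (hWu : IsUnitaryCfg W) {a : ℝ} (ha : 0 ≤ a) (hWa : SmallField W a) (ξ : Site d → Matrix n n ℂ) :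
    ∑ y ∈ periodBox (d := d) (M * N), nhsNormSq (ξ y)
      ≤ 2 * ((M : ℝ) ^ 2 * ∑ y ∈ periodBox (d := d) (M * N), ∑ μ : Fin d, nhsNormSq (gaugeDir W ξ y μ))
        + 2 * (4 * d * ((M : ℝ) * (((d : ℝ) - 1) * ((M : ℝ) - 1) * a)) ^ 2) * ∑ y ∈ periodBox (d := d) (M * N), nhsNormSq (ξ y)
        + 2 * ∑ z ∈ periodBox (d := d) N, (M : ℝ) ^ d * nhsNormSq (bmeanW M W ξ z) := by
  rw [← sum_blocks_torus hM N (fun y => nhsNormSq (ξ y)), ← sum_blocks_torus hM N (fun y => ∑ μ : Fin d, nhsNormSq (gaugeDir W ξ y μ)),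
    mul_sum, mul_sum, mul_sum, mul_sum, ← sum_add_distrib, ← sum_add_distrib]
  refine sum_le_sum fun z _ => ?_
  have hK2 := sum_nhsNormSq_sub_combMean_le hM hWu ha hWa ξ z
  have hmass := sum_nhsNormSq_Ad_inv_const (M := M) hWu z (bmeanW M W ξ z)
  -- pointwise: ξ = (ξ − Φ m) + Φ m
  have hpt : ∀ v ∈ periodBox (d := d) M, nhsNormSq (ξ ((M : ℤ) • z + v))
      ≤ 2 * (nhsNormSq (ξ ((M : ℤ) • z + v) - Ad (btree M W z ((M : ℤ) • z + v))⁻¹ (bmeanW M W ξ z))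
        + nhsNormSq (Ad (btree M W z ((M : ℤ) • z + v))⁻¹ (bmeanW M W ξ z))) := by
    intro v _
    have h := nhsNormSq_sub_le
      (ξ ((M : ℤ) • z + v) - Ad (btree M W z ((M : ℤ) • z + v))⁻¹ (bmeanW M W ξ z))
      (-Ad (btree M W z ((M : ℤ) • z + v))⁻¹ (bmeanW M W ξ z))
    rwa [sub_neg_eq_add, sub_add_cancel, nhsNormSq_neg] at h
  have hsum := sum_le_sum hpt
  rw [← mul_sum, sum_add_distrib, hmass] at hsum
  nlinarith [hK2, hsum]

/-! ## §2 The Poincaré inequality on the nested-block-mean-zero gauge parameters -/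

/-- **POINCARÉ ON `{bmeanIterW L k W ξ = 0}` WITH THE ABSORBABLE MASS DISPLAYED** (`L ≥ 2`, `k = j+1`, `M = L^k`; unitary `W`,
`0 ≤ x`, `LevelSmall d L j x`, `SmallField W x`; ANY `N`, ANY `ξ` with `bmeanIterW L (j+1) W ξ z = 0` for `z ∈ periodBox N`):
`Σ_y nhsNormSq (ξ y) ≤ 2M²·Σ_yΣ_μ nhsNormSq (gaugeDir W ξ y μ) + (8d((d−1)M(M−1)x)² + 2·card n·C_J2²)·Σ_y nhsNormSq (ξ y)`,
`C_J2 = 4d²(M−1)²x + 16d·loopRad(d,L,(prop1Radius d L)^[j] x)`. [folklore] -/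
theorem sum_nhsNormSq_le_of_bmeanIterW_eq_zero [Nonempty n] {L : ℕ} (hL : 2 ≤ L) (j : ℕ) {W : Site d → Fin d → (Matrix n n ℂ)ˣ}
    {x : ℝ} (hWu : IsUnitaryCfg W) (hx : 0 ≤ x) (hsm : LevelSmall d L j x) (hWx : SmallField W x) (N : ℕ)
    (ξ : Site d → Matrix n n ℂ) (hξ : ∀ z ∈ periodBox (d := d) N, bmeanIterW L (j + 1) W ξ z = 0) :
    ∑ y ∈ periodBox (d := d) (L ^ (j + 1) * N), nhsNormSq (ξ y)
      ≤ 2 * (((L : ℝ) ^ (j + 1)) ^ 2 * ∑ y ∈ periodBox (d := d) (L ^ (j + 1) * N), ∑ μ : Fin d, nhsNormSq (gaugeDir W ξ y μ))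
        + (8 * d * (((L : ℝ) ^ (j + 1)) * (((d : ℝ) - 1) * (((L : ℝ) ^ (j + 1)) - 1) * x)) ^ 2
            + 2 * (Fintype.card n * (4 * (d : ℝ) ^ 2 * ((L : ℝ) ^ (j + 1) - 1) ^ 2 * x
                + 16 * d * loopRad d L ((prop1Radius d L)^[j] x)) ^ 2))
          * ∑ y ∈ periodBox (d := d) (L ^ (j + 1) * N), nhsNormSq (ξ y) := by
  have hM : 1 ≤ L ^ (j + 1) := Nat.one_le_pow _ _ (by omega)
  have h2 := sum_nhsNormSq_le_two_blocks hM N hWu hx hWx ξ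
  have hJ := sum_nhsNormSq_bmeanIterW_sub_bmeanW_le hL j hWu hx hsm hWx ξ N
  -- with vanishing nested mean the bridge IS the mass of the single-scale mean
  have hmass : ∑ z ∈ periodBox (d := d) N, ((L : ℝ) ^ (j + 1)) ^ d * nhsNormSq (bmeanW (L ^ (j + 1)) W ξ z)
      = ∑ z ∈ periodBox (d := d) N, ((L : ℝ) ^ (j + 1)) ^ d * nhsNormSq (bmeanIterW L (j + 1) W ξ z - bmeanW (L ^ (j + 1)) W ξ z) := by
    refine sum_congr rfl fun z hz => ?_
    rw [hξ z hz, zero_sub, nhsNormSq_neg]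
  push_cast at h2
  rw [hmass] at h2
  nlinarith [h2, hJ, sum_nonneg (fun y (_ : y ∈ periodBox (d := d) (L ^ (j + 1) * N)) => nhsNormSq_nonneg (ξ y))]

/-- **THE ABSORBED FORM**: under the displayed smallness `8d((d−1)M(M−1)x)² + 2·card n·C_J2² ≤ 1∕2` (k-free: both terms are
`O((L²a-type radius)²)` in the chart's class), `Σ_y nhsNormSq (ξ y) ≤ 4·M²·Σ_yΣ_μ nhsNormSq (gaugeDir W ξ y μ)`. [folklore] -/
theorem sum_nhsNormSq_le_four_mul_of_bmeanIterW_eq_zero [Nonempty n] {L : ℕ} (hL : 2 ≤ L) (j : ℕ)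
    {W : Site d → Fin d → (Matrix n n ℂ)ˣ} {x : ℝ} (hWu : IsUnitaryCfg W) (hx : 0 ≤ x) (hsm : LevelSmall d L j x)
    (hWx : SmallField W x) (N : ℕ) (ξ : Site d → Matrix n n ℂ) (hξ : ∀ z ∈ periodBox (d := d) N, bmeanIterW L (j + 1) W ξ z = 0)
    (hsmall : 8 * d * (((L : ℝ) ^ (j + 1)) * (((d : ℝ) - 1) * (((L : ℝ) ^ (j + 1)) - 1) * x)) ^ 2
      + 2 * (Fintype.card n * (4 * (d : ℝ) ^ 2 * ((L : ℝ) ^ (j + 1) - 1) ^ 2 * x + 16 * d * loopRad d L ((prop1Radius d L)^[j] x)) ^ 2)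
        ≤ 1 / 2) :
    ∑ y ∈ periodBox (d := d) (L ^ (j + 1) * N), nhsNormSq (ξ y)
      ≤ 4 * (((L : ℝ) ^ (j + 1)) ^ 2 * ∑ y ∈ periodBox (d := d) (L ^ (j + 1) * N), ∑ μ : Fin d, nhsNormSq (gaugeDir W ξ y μ)) := by
  have h := sum_nhsNormSq_le_of_bmeanIterW_eq_zero hL j hWu hx hsm hWx N ξ hξ
  have hS : 0 ≤ ∑ y ∈ periodBox (d := d) (L ^ (j + 1) * N), nhsNormSq (ξ y) := sum_nonneg fun y _ => nhsNormSq_nonneg _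
  have hG : 0 ≤ ((L : ℝ) ^ (j + 1)) ^ 2 * ∑ y ∈ periodBox (d := d) (L ^ (j + 1) * N), ∑ μ : Fin d, nhsNormSq (gaugeDir W ξ y μ) :=
    mul_nonneg (by positivity) (sum_nonneg fun y _ => sum_nonneg fun μ _ => nhsNormSq_nonneg _)
  nlinarith [mul_le_mul_of_nonneg_right hsmall hS]

end

end Summit.QuantumFields.BalabanUV.T4Continuum.NE3CornerGaugePoincare
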